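import Literature.Geometry.Lorentzian.KerrTimeDerivative
import HarnessLib

/-!
# Support of the data of `Tψ`: the time derivative preserves data supported away from an open
# set, in particular data supported in a coordinate ball; iterated time derivatives

(family `gr`, infrastructure for **gr.S24**; namespace `Literature.Geometry.Lorentzian`)

`KerrTimeDerivative.lean` proves that the time derivative `Tψ = ∂_{t*}ψ` (`timeDeriv`) of an
admissible Kerr wave is an admissible Kerr wave with the *same compact data-support set `K`*
(`IsAdmissibleKerrWave.timeDeriv`, from `Kerr.fderiv_fderiv_extend_eq_zero_of_data`: all second
derivatives of `ψ̃` vanish at the data-free points of the slice `{t* = 0}`). The decay statements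
of Dafermos–Rodnianski–Shlapentokh-Rothman in flux form (`Kerr.drsr_corollary_3_1_scri_flux_decay`,
`KerrHyperboloidalFlux.lean`, and the hierarchy of `KerrDecayHierarchy.lean`) carry their support
hypothesis in a different shape — the data vanish at the slice points with `‖x⃗‖ > R₁` — and the
`r^p` iteration (arXiv:0910.4957, §4: "using the above inequality again with `φ` replaced by
`Tφ`") needs that shape to be preserved by `T`. This short file supplies it:

* `IsAdmissibleKerrWave.timeDeriv_data_eq_zero_of_isOpen` (**proved**): if the data of an
  admissible wave `ψ` (`M ≥ 0`) vanish moreover at the slice points of an open set `O ⊆ E4`, so do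
  the data of `Tψ` — apply `Kerr.fderiv_fderiv_extend_eq_zero_of_data` with the compact set
  `K ∩ Oᶜ`, off which the data vanish;
* `IsAdmissibleKerrWave.timeDeriv_data_eq_zero_of_lt_spatialNorm` (**proved**): the case
  `O = {‖x⃗‖ > R₁}` (the hypothesis shape of `Kerr.drsr_corollary_3_1_scri_flux_decay`);
* `IsAdmissibleKerrWave.timeDeriv_iterate` (**proved**): `T^k ψ` is admissible for every `k`
  (DRSR Thm. 3.2 commutes `j − 1` times).

## References

* M. Dafermos, I. Rodnianski, Y. Shlapentokh-Rothman, *Decay for solutions of the wave equation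
  on Kerr exterior spacetimes III: the full subextremal case `|a| < M`*, Ann. of Math. 183 (2016)
  787–913, arXiv:1402.7034, §2.2.2 (`T` Killing), §3.2 Thm. 3.2 (commuted energies), §4.1 (smooth
  compactly supported data) (key `DafermosRodnianskiShlapentokhrothman2014`).
* M. Dafermos, I. Rodnianski, *A new physical-space approach to decay for the wave equation with
  applications to black hole spacetimes*, arXiv:0910.4957, §4 (key `DafermosRodnianski2010ICMP`).
-/

noncomputable section

open Set Filter
open scoped Topology Manifold ContDiff

namespace Literature.Geometry.Lorentzian

/-- **The data of `Tψ` vanish where the data of `ψ` vanish (open-set form).** Let `ψ` be an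
admissible Kerr wave (`M ≥ 0`) whose data `(ψ, dψ)` vanish, in addition, at all points of the
slice `{t* = 0}` lying in an open set `O ⊆ E4`. Then `Tψ = 0` and `d(Tψ) = 0` at those points.
Proof: the data vanish off the compact set `K ∩ Oᶜ` (`K` the data-support set of `ψ`), so
`Kerr.fderiv_fderiv_extend_eq_zero_of_data` gives `D²ψ̃ = 0` at the slice points of `O`, while
`Tψ = ∂₀ψ̃ = 0` there directly. DRSR arXiv:1402.7034, §4.1 (the class of smooth compactly
supported data is preserved by commutation with `T`, §2.2.2). [cite: DafermosRodnianskiShlapentokhrothman2014, §4.1] -/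
theorem IsAdmissibleKerrWave.timeDeriv_data_eq_zero_of_isOpen [Kerr.Facts] [Kerr.SliceFacts]
    {M a : ℝ} (hM : 0 ≤ M) {ψ : Kerr.region a (Kerr.rPlus M a) → ℝ}
    (hψ : IsAdmissibleKerrWave M a ψ) {O : Set E4} (hO : IsOpen O)
    (hvan : ∀ x : Kerr.region a (Kerr.rPlus M a), (x : E4) 0 = 0 → (x : E4) ∈ O →
      ψ x = 0 ∧ mfderiv 𝓘(ℝ, E4) 𝓘(ℝ, ℝ) ψ x = 0)
    (x : Kerr.region a (Kerr.rPlus M a)) (hx0 : (x : E4) 0 = 0) (hxO : (x : E4) ∈ O) :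
    Literature.Geometry.Lorentzian.timeDeriv ψ x = 0 ∧
      mfderiv 𝓘(ℝ, E4) 𝓘(ℝ, ℝ) (Literature.Geometry.Lorentzian.timeDeriv ψ) x = 0 := by
  obtain ⟨hsmooth, hsol, K, hK, hdata⟩ := hψ
  -- the data vanish off the compact set `K' = K ∩ Oᶜ`, and `x ∉ K'`
  set K' : Set (Kerr.region a (Kerr.rPlus M a)) := K ∩ Subtype.val ⁻¹' Oᶜ with hK'
  have hK'c : IsCompact K' :=
    hK.inter_right (hO.isClosed_compl.preimage continuous_subtype_val)
  have hdata' : ∀ z : Kerr.region a (Kerr.rPlus M a), (z : E4) 0 = 0 → z ∉ K' →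
      ψ z = 0 ∧ mfderiv 𝓘(ℝ, E4) 𝓘(ℝ, ℝ) ψ z = 0 := by
    intro z hz0 hzK'
    by_cases hzO : (z : E4) ∈ O
    · exact hvan z hz0 hzO
    · exact hdata z hz0 fun hzK ↦ hzK' ⟨hzK, hzO⟩
  have hxK' : x ∉ K' := fun h ↦ h.2 hxO
  -- the argument of `IsAdmissibleKerrWave.timeDeriv` at the point `x`, with `K'`
  set Φ : E4 → ℝ := Function.extend Subtype.val ψ 0 with hΦ
  have hdΦ : fderiv ℝ Φ x = 0 :=
    Kerr.fderiv_extend_eq_zero (by simp) hsmooth x (hdata' x hx0 hxK').2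
  have hΦ2 : ContDiffAt ℝ 2 Φ x := (contDiffAt_extend hsmooth x).of_le (by norm_cast)
  refine ⟨by simp [Literature.Geometry.Lorentzian.timeDeriv, ← hΦ, hdΦ], ?_⟩
  have hdiff : DifferentiableAt ℝ (fun y ↦ fderiv ℝ Φ y (E4.basisVector 0)) x :=
    (contDiffAt_fderiv_apply_const (n := 1) (by exact_mod_cast hΦ2) _).differentiableAt
      one_ne_zero
  have hD2 : fderiv ℝ (fderiv ℝ Φ) x = 0 :=
    Kerr.fderiv_fderiv_extend_eq_zero_of_data hM a _ hsmooth hsol hK'c hdata' hx0 hxK'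
  have hzero : fderiv ℝ (fun y ↦ fderiv ℝ Φ y (E4.basisVector 0)) x = 0 := by
    rw [fderiv_partial_eq_flip hΦ2, hD2]
    simp
  rw [OpensChart.mfderiv_eq x (Literature.Geometry.Lorentzian.timeDeriv ψ) _ (timeDeriv_rep ψ)
    hdiff]
  exact hzero

/-- **Data supported in a coordinate ball stay supported in the ball under `T`** (`M ≥ 0`): if the
data of an admissible wave `ψ` vanish at the slice points with `‖x⃗‖ > R₁` — the support hypothesis
of `Kerr.drsr_corollary_3_1_scri_flux_decay` — so do the data of `Tψ` (the case
`O = {‖x⃗‖ > R₁}` of `timeDeriv_data_eq_zero_of_isOpen`). DRSR arXiv:1402.7034, §4.1. [cite: DafermosRodnianskiShlapentokhrothman2014, §4.1] -/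
theorem IsAdmissibleKerrWave.timeDeriv_data_eq_zero_of_lt_spatialNorm [Kerr.Facts]
    [Kerr.SliceFacts] {M a : ℝ} (hM : 0 ≤ M) {ψ : Kerr.region a (Kerr.rPlus M a) → ℝ}
    (hψ : IsAdmissibleKerrWave M a ψ) {R₁ : ℝ}
    (hvan : ∀ x : Kerr.region a (Kerr.rPlus M a), (x : E4) 0 = 0 → R₁ < E4.spatialNorm (x : E4) →
      ψ x = 0 ∧ mfderiv 𝓘(ℝ, E4) 𝓘(ℝ, ℝ) ψ x = 0) :
    ∀ x : Kerr.region a (Kerr.rPlus M a), (x : E4) 0 = 0 → R₁ < E4.spatialNorm (x : E4) →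
      Literature.Geometry.Lorentzian.timeDeriv ψ x = 0 ∧
        mfderiv 𝓘(ℝ, E4) 𝓘(ℝ, ℝ) (Literature.Geometry.Lorentzian.timeDeriv ψ) x = 0 :=
  have hO : IsOpen {z : E4 | R₁ < E4.spatialNorm z} :=
    isOpen_lt continuous_const (continuous_norm.comp E4.spatial.continuous)
  fun x hx0 hxR ↦ hψ.timeDeriv_data_eq_zero_of_isOpen hM hO (fun z hz0 hzO ↦ hvan z hz0 hzO) x hx0 hxR

/-- **Iterated time derivatives `T^k ψ` of an admissible Kerr wave are admissible Kerr waves**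
(`M ≥ 0`; `IsAdmissibleKerrWave.timeDeriv` iterated). DRSR arXiv:1402.7034, Thm. 3.2 (the
commuted quantities of order `j − 1`). [cite: DafermosRodnianskiShlapentokhrothman2014, §2.2.2] -/
theorem IsAdmissibleKerrWave.timeDeriv_iterate [Kerr.Facts] [Kerr.SliceFacts] {M a : ℝ}
    (hM : 0 ≤ M) {ψ : Kerr.region a (Kerr.rPlus M a) → ℝ} (h : IsAdmissibleKerrWave M a ψ)
    (k : ℕ) : IsAdmissibleKerrWave M a (Literature.Geometry.Lorentzian.timeDeriv^[k] ψ) := by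
  induction k with
  | zero => simpa using h
  | succ k ih =>
    rw [Function.iterate_succ_apply']
    exact ih.timeDeriv hM

/-- The iterates also keep data supported in a coordinate ball (`M ≥ 0`). DRSR arXiv:1402.7034,
§4.1. [cite: DafermosRodnianskiShlapentokhrothman2014, §4.1] -/
theorem IsAdmissibleKerrWave.timeDeriv_iterate_data_eq_zero_of_lt_spatialNorm [Kerr.Facts]
    [Kerr.SliceFacts] {M a : ℝ} (hM : 0 ≤ M) {ψ : Kerr.region a (Kerr.rPlus M a) → ℝ}
    (hψ : IsAdmissibleKerrWave M a ψ) {R₁ : ℝ}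
    (hvan : ∀ x : Kerr.region a (Kerr.rPlus M a), (x : E4) 0 = 0 → R₁ < E4.spatialNorm (x : E4) →
      ψ x = 0 ∧ mfderiv 𝓘(ℝ, E4) 𝓘(ℝ, ℝ) ψ x = 0) (k : ℕ) :
    ∀ x : Kerr.region a (Kerr.rPlus M a), (x : E4) 0 = 0 → R₁ < E4.spatialNorm (x : E4) →
      (Literature.Geometry.Lorentzian.timeDeriv^[k] ψ) x = 0 ∧
        mfderiv 𝓘(ℝ, E4) 𝓘(ℝ, ℝ) (Literature.Geometry.Lorentzian.timeDeriv^[k] ψ) x = 0 := by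
  induction k with
  | zero => exact hvan
  | succ k ih =>
    rw [Function.iterate_succ_apply']
    exact (hψ.timeDeriv_iterate hM k).timeDeriv_data_eq_zero_of_lt_spatialNorm hM ih

end Literature.Geometry.Lorentzian

end
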